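import Mathlib
import Summits.Ventures.PercRepro2.TypedSepThreeSort

/-!
# The `{o, a₂}`-pocket class (HARRIS-2), I: the gluing and the doubly symmetrised kernel (blind
cell PercRepro2, p3 g8, 2026-08-26; `proofs/P3-HARRIS.md` §6)

The doors are now the mark `o` and the root `a₂`; the POCKET holds `b` (pocket state
`(o~b, a₂~b, o~a₂)` inside it, the type `SepThree.OSt` through `PocketAB.oStP ends b o a₂`), the
far side holds `a₁, a₃` (far state `(a₂~a₁, a₂~a₃, a₁~a₃, a₁~o, a₂~o, a₃~o)` inside it, the type
`SepThree.BSt` through `SepThree.bSt ends a₁ a₂ a₃ o`).  The glued state `gluedQ` is the raw output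
of the two-door closure lemmas (`TypedSepThreeClosure.lean`) with the doors `o, a₂`; the
`S₃ × S₃`-symmetrised kernel `dsymQ` is symmetric in either side's copies and is invariant under
sorting them (`dsymQ_sort3O`, `dsymQ_sort3B`).  `dsymQ` is NOT pointwise nonnegative (min `−12`):
the class is certified in `TypedPocketOA2CertA/B.lean` by typed-Harris-with-spectator slacks on
the pocket side.  Own work; standard axioms.
-/

namespace Summit.Ventures.PercRepro2

namespace CovForm

namespace PocketOA2

open OneTyped SepThree

/-! ## The gluing with the doors `o, a₂` -/

/-- **The glued state** of a copy from its pocket state `(p_o, p₂, X) = (o~b, a₂~b, o~a₂)` and its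
far state `(h₁₂, h₃₂, Y, c₁, c₂, c₃) = (a₂~a₁, a₂~a₃, a₁~a₃, a₁~o, a₂~o, a₃~o)`: with `D = X ∨ c₂`
(`o ~ a₂`), `a₂~a₁ = h₁₂ ∨ (D ∧ c₁)`, `a₁~o = c₁ ∨ (D ∧ h₁₂)`, `a₂~o = D`, `a₂~b = p₂ ∨ (D ∧ p_o)`,
`o~b = p_o ∨ (D ∧ p₂)`, `a₁~b = (a₁~o ∧ o~b) ∨ (a₁~a₂ ∧ a₂~b)`,
`a₁~a₃ = Y ∨ (D ∧ ((c₁ ∧ h₃₂) ∨ (h₁₂ ∧ c₃)))`, `a₂~a₃ = h₃₂ ∨ (D ∧ c₃)`. -/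
def gluedQ (s : OSt) (t : BSt) : St :=
  let po := s.1
  let p2 := s.2.1
  let X := s.2.2
  let h12 := t.1
  let h32 := t.2.1
  let Y := t.2.2.1
  let c1 := t.2.2.2.1
  let c2 := t.2.2.2.2.1
  let c3 := t.2.2.2.2.2
  let D := X || c2
  let q := h12 || (D && c1)
  let Lo := c1 || (D && h12)
  let Hb := p2 || (D && po)
  let ob := po || (D && p2)
  let L3 := Y || (D && ((c1 && h32) || (h12 && c3)))
  let H3 := h32 || (D && c3)
  (q, Lo, D, (Lo && ob) || (q && Hb), Hb, L3, H3)

/-- The kernel on glued state triples. -/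
def psiQ (x y w : OSt) (u v r : BSt) : ℤ := KB (gluedQ x u) (gluedQ y v) (gluedQ w r)

/-- **The doubly symmetrised kernel** (36 terms: the o-states and the far states permuted
independently). -/
def dsymQ (x y w : OSt) (u v r : BSt) : ℤ :=
  (psiQ x y w u v r + psiQ x y w u r v + psiQ x y w v u r + psiQ x y w v r u + psiQ x y w r u v +
      psiQ x y w r v u) +
  (psiQ x w y u v r + psiQ x w y u r v + psiQ x w y v u r + psiQ x w y v r u + psiQ x w y r u v +
      psiQ x w y r v u) +
  (psiQ y x w u v r + psiQ y x w u r v + psiQ y x w v u r + psiQ y x w v r u + psiQ y x w r u v +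
      psiQ y x w r v u) +
  (psiQ y w x u v r + psiQ y w x u r v + psiQ y w x v u r + psiQ y w x v r u + psiQ y w x r u v +
      psiQ y w x r v u) +
  (psiQ w x y u v r + psiQ w x y u r v + psiQ w x y v u r + psiQ w x y v r u + psiQ w x y r u v +
      psiQ w x y r v u) +
  (psiQ w y x u v r + psiQ w y x u r v + psiQ w y x v u r + psiQ w y x v r u + psiQ w y x r u v +
      psiQ w y x r v u)

/-- `dsymQ` is symmetric in the first two o-states. -/
lemma dsymQ_swapO12 (x y w : OSt) (u v r : BSt) : dsymQ x y w u v r = dsymQ y x w u v r := by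
  unfold dsymQ; ring

/-- `dsymQ` is symmetric in the last two o-states. -/
lemma dsymQ_swapO23 (x y w : OSt) (u v r : BSt) : dsymQ x y w u v r = dsymQ x w y u v r := by
  unfold dsymQ; ring

/-- `dsymQ` is symmetric in the first two far states. -/
lemma dsymQ_swapB12 (x y w : OSt) (u v r : BSt) : dsymQ x y w u v r = dsymQ x y w v u r := by
  unfold dsymQ; ring

/-- `dsymQ` is symmetric in the last two far states. -/
lemma dsymQ_swapB23 (x y w : OSt) (u v r : BSt) : dsymQ x y w u v r = dsymQ x y w u r v := by
  unfold dsymQ; ring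

/-- `dsymQ` is unchanged by sorting the o-states. -/
lemma dsymQ_sort3O (x y w : OSt) (u v r : BSt) :
    dsymQ x y w u v r = dsymQ (sort3O x y w).1 (sort3O x y w).2.1 (sort3O x y w).2.2 u v r := by
  unfold sort3O
  split_ifs <;> dsimp only <;>
    first
    | rfl
    | exact dsymQ_swapO12 x y w u v r
    | exact dsymQ_swapO23 x y w u v r
    | exact (dsymQ_swapO12 x y w u v r).trans (dsymQ_swapO23 y x w u v r)
    | exact (dsymQ_swapO23 x y w u v r).trans (dsymQ_swapO12 x w y u v r)
    | exact ((dsymQ_swapO12 x y w u v r).trans (dsymQ_swapO23 y x w u v r)).trans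
        (dsymQ_swapO12 y w x u v r)

/-- `dsymQ` is unchanged by sorting the far states. -/
lemma dsymQ_sort3B (x y w : OSt) (u v r : BSt) :
    dsymQ x y w u v r = dsymQ x y w (sort3B u v r).1 (sort3B u v r).2.1 (sort3B u v r).2.2 := by
  unfold sort3B
  split_ifs <;> dsimp only <;>
    first
    | rfl
    | exact dsymQ_swapB12 x y w u v r
    | exact dsymQ_swapB23 x y w u v r
    | exact (dsymQ_swapB12 x y w u v r).trans (dsymQ_swapB23 x y w v u r)
    | exact (dsymQ_swapB23 x y w u v r).trans (dsymQ_swapB12 x y w u r v)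
    | exact ((dsymQ_swapB12 x y w u v r).trans (dsymQ_swapB23 x y w v u r)).trans
        (dsymQ_swapB12 x y w v r u)

end PocketOA2

end CovForm

end Summit.Ventures.PercRepro2
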